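import Mathlib
import HarnessLib
import Summits.HubbardSuperconductivity.HubbardSuperconductivity.Theorems.KLProgrammeKLRegimeIsoSectorMultiplierSingleDiffs
import Summits.HubbardSuperconductivity.HubbardSuperconductivity.Theorems.KLProgrammeH10TwoPointLimitIsoTorusRates
import Summits.HubbardSuperconductivity.HubbardSuperconductivity.Theorems.KLProgrammeH10TwoPointLimitSectorMultiplierL1
import Summits.HubbardSuperconductivity.HubbardSuperconductivity.Theorems.KLProgrammeKLRegimeSectorMultiplierWtRates
import Summits.HubbardSuperconductivity.HubbardSuperconductivity.Theorems.KLProgrammeKLRegimeTorusL1DyadicSuperpositionWt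

/-!
# Route `KLProgramme` — engine support (stmt-HubbardSuperconductivity-20437, row (b) producer `hexI`, geometry datum `hisoW`): the UNIFORM WEIGHTED `ℓ¹` bound
# (one position moment at the ISOTROPIC rate `Λ_m`) of the `(ℤ/2M) × (ℤ/L)²` character sum of ONE isotropic sector function `F_σ = klIsoFamily … m σ` on an
# admissible frame: `Σ_z (1 + (Λ_mβ/2M)|z̃₀| + Λ_m|z̃₁| + Λ_m|z̃₂|)·‖S[F_σ](z)‖ ≤ C_iso·M·L²`, `C_iso` INDEPENDENT of `m, σ, β, L, M` and of the frame
# (brick (F2) of the `hisoW` supplier; cell gate-hubbard-kl, seat p3 g24)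

The isotropic twin of p3 g10's W1 `charSumWt_klAniso_le_uniform` and the weighted twin of p4 g7's `iso_torusSum_le_frame`: the pointwise pack
`…IsoSectorMultiplierSingleDiffs` (third differences in time and along the axes at the isotropic rate; support count) is fed into the AXES-ONLY weighted master
lemma `sum_wt_norm_charSum_le_of_third_differences_axes` (no tangent frame is needed at the isotropic rate); rates without cube roots `s₀ = 2Λβ/(2M·π·κ_t)`
(`κ_t = max 1 c_T`), `s₁ = 2Λ/(πκ)` (`κ = max 1 κ₃`, `κ₃` p3 g10's isotropic order-three constant `iso3_pack_le`); bookkeeping by `tfac_le`, `iso_bracket_le`,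
`iso_supp_le`, `cu_rate_time_le`, `cu_rate_space_le`.
* §1 `isoWt_sqrt_assemble` — the product of the two square roots of the master bound is `≤ √(ab)·M·L²`;
* §2 **`charSumWt_klIso_le_rates`** (master-rate weights) and **`charSumWt_klIso_le_uniform`** (the weights of the engine's `hisoW` datum:
  time rate `Λ_mβ/(2M)`, space rate `Λ_m`), under `Λ_mβ < π(2M−5)`, `βe₀ ≤ M`, `3|2π/L| ≤ z`, `1 ≤ LΛ_m`, `π/(4β) ≤ Λ_m`, `A₃Λ_m² ≤ a₃`.
Everything is proved; no definitions, no named facts. [cite: BenfattoGiulianiMastropietro2006, Lemma 2.2 (2.52)–(2.56), §2.6 (2.81)]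
-/

noncomputable section

namespace Summit.HubbardSuperconductivity.HubbardSuperconductivity.Theorems.TorusFourierL2

set_option linter.dupNamespace false -- summit = problem name (single-conjunct summit), D-0017

open Set Finset Literature.MathematicalPhysics.QuantumLattice Literature.MathematicalPhysics.QuantumLattice.BandSectorCounting
open Literature.MathematicalPhysics.QuantumLattice.FermiRG Literature.Probability.LatticeModels Literature.Analysis.SpecialFunctions
open Summit.HubbardSuperconductivity.HubbardSuperconductivity.Theorems.DispersionFlow
open Summit.HubbardSuperconductivity.HubbardSuperconductivity.Theorems.KLRegimeSplit
open Summit.HubbardSuperconductivity.HubbardSuperconductivity.Theorems.KLProgrammeLegKernels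
open Summit.HubbardSuperconductivity.HubbardSuperconductivity.Theorems.PerturbedFermiCurve
open scoped Real

/-! ## §1 The square-root assembly -/

/-- **Assembly**: `X₁ ≤ a(M/(Λβ))/Λ²` and `X₂ ≤ bM(Λβ)(L²(LΛ)²)` give `√X₁·√X₂·1 ≤ √(ab)·M·L²`. [folklore] -/
theorem isoWt_sqrt_assemble {X₁ X₂ Λ β M L a b : ℝ} (hX₁ : 0 ≤ X₁) (hX₂ : 0 ≤ X₂) (ha : 0 ≤ a) (hb : 0 ≤ b) (hM : 0 ≤ M)
    (hΛ : 0 < Λ) (hβ : 0 < β) (h1 : X₁ ≤ a * (M / (Λ * β)) / Λ ^ 2) (h2 : X₂ ≤ b * M * (Λ * β) * (L ^ 2 * (L * Λ) ^ 2)) :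
    Real.sqrt X₁ * Real.sqrt X₂ * 1 ≤ Real.sqrt (a * b) * M * L ^ 2 := by
  rw [mul_one, ← Real.sqrt_mul hX₁]
  have hR0 : 0 ≤ a * (M / (Λ * β)) / Λ ^ 2 := by positivity
  have hprod : X₁ * X₂ ≤ a * b * (M * L ^ 2) ^ 2 := by
    calc X₁ * X₂ ≤ (a * (M / (Λ * β)) / Λ ^ 2) * (b * M * (Λ * β) * (L ^ 2 * (L * Λ) ^ 2)) := mul_le_mul h1 h2 hX₂ hR0
      _ = a * b * (M * L ^ 2) ^ 2 := by field_simp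
  calc Real.sqrt (X₁ * X₂) ≤ Real.sqrt (a * b * (M * L ^ 2) ^ 2) := Real.sqrt_le_sqrt hprod
    _ = Real.sqrt (a * b) * M * L ^ 2 := by rw [Real.sqrt_mul (mul_nonneg ha hb), Real.sqrt_sq (by positivity)]; ring

/-! ## §2 The uniform weighted bound of one isotropic sector function -/

section IsoWt

variable {L M : ℕ} [NeZero L] [NeZero M] {a b : ℝ} (B : BandBounds a b) {K : TrigPolyC4v} {A A₃ a₃ : ℝ}
  (hA : ∀ p : Momentum, ∀ j ≤ 2, ‖iteratedFDeriv ℝ j (frameShift K) p‖ ≤ A) (hADt : 2 * A < B.Dtmin)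
  (hA3 : ∀ p : Momentum, ‖iteratedFDeriv ℝ 3 (frameShift K) p‖ ≤ A₃)
  {μ e₀ z β : ℝ} (he : 0 < e₀) (hz : 0 < z) (hz1 : z ≤ 1) (hgap : e₀ + A + z ^ 2 < -μ) (h3 : e₀ + A - μ ≤ 3)
  (hlo : a ≤ μ - A - e₀) (hhi : μ + A + e₀ ≤ b) (hβ : 0 < β) (hρA : 4 * A < 2 * B.rhomin)
  {m : ℕ} (σ : Fin (sectorCount (2 * m)))
  {d : ℝ} (hd : 0 ≤ d) (hd1 : ∀ u, |deriv (bgmCutoffSq e₀) u| ≤ d) (hd2 : ∀ u, |iteratedDeriv 2 (bgmCutoffSq e₀) u| ≤ d)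
  (hd3 : ∀ u, |iteratedDeriv 3 (bgmCutoffSq e₀) u| ≤ d)
  {Z : (Fin 2 → ℝ) → ℝ}
  (hZ : ∀ p, Z p = gnCutoff ((π + z) ^ 2 / π ^ 2) ((π + z) ^ 2) (p 0 ^ 2) * gnCutoff ((π + z) ^ 2 / π ^ 2) ((π + z) ^ 2) (p 1 ^ 2) *
    (radialCutoffC (1 / 2) (momToComplex p) * sectorWeightCirc (2 * m) ((σ : ℕ) : ℤ) (polarAngle p)))
  {Φ : ℝ × (Fin 2 → ℝ) → ℂ}
  (hΦ : ∀ k₀ p, Φ (k₀, p) = ((bgmCutoffSq e₀ ((16 : ℝ) ^ m * (k₀ ^ 2 + frameLevel μ K (WithLp.toLp 2 p) ^ 2)) * Z p : ℝ) : ℂ))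
  {Gs : TorusSite 1 (2 * M) × TorusSite 2 L → ℂ}
  (hGs : ∀ q, Gs q = klIsoFamily L M β μ K e₀ m σ (⟨(q.1 0).val, ZMod.val_lt (q.1 0)⟩, q.2))
  -- the angular constant of `exists_norm_iteratedDeriv_sectorWeightCirc_polarAngle_line_le 3`
  {Ba : ℝ} (hB0 : 0 < Ba)
  (hB : ∀ (i : ℕ), i ≤ 3 → ∀ (n : ℕ) (ω : ℤ) (θ₀ : ℝ) (q w : Fin 2 → ℝ) (t : ℝ) {r₀ : ℝ}, 0 < r₀ →
    r₀ ≤ ‖momToComplex (q + t • w)‖ → |sectorRelAngle θ₀ (q + t • w)| < π →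
    ‖iteratedDeriv i (fun t : ℝ => sectorWeightCirc n ω (polarAngle (q + t • w))) t‖ ≤
      (3 : ℕ).factorial * Ba * ((1 + (sectorWidth n)⁻¹ * (3 : ℕ).factorial) * ‖momToComplex w‖ / r₀) ^ i)
  -- the named constants (parameters with defining equations; instantiate with `rfl`)
  {cT κt G₁ K₂ κ₃ κ Kc r κX cN : ℝ}
  (hcT : cT = 8 * (d * e₀ ^ 6) + 12 * (d * e₀ ^ 4))
  (hκt : κt = max 1 cT)
  (hG₁ : G₁ = 4 + 2 * A) (hK₂ : K₂ = 4 + 4 * A)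
  (hκ₃ : κ₃ = (8 * (d * e₀ ^ 6) + 12 * (d * e₀ ^ 4)) * G₁ ^ 3 + (12 * (d * e₀ ^ 4) + 6 * (d * e₀ ^ 2)) * G₁ * K₂ * e₀ +
    2 * (d * e₀ ^ 2) * (4 * e₀ ^ 2 + 8 * a₃) +
    108 * Ba * ((4 * (d * e₀ ^ 4) + 2 * (d * e₀ ^ 2)) * G₁ ^ 2 * e₀ + 2 * (d * e₀ ^ 2) * K₂ * e₀ ^ 2) +
    1296 * (d * e₀ ^ 2) * G₁ * Ba * e₀ ^ 2 + 1296 * Ba * e₀ ^ 3)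
  (hκ : κ = max 1 κ₃) (hKc : Kc = κ ^ 2)
  (hr : r = (1 + 3 * π * B.smax * B.Dtmin / (4 * e₀)) / (B.Dtmin - 2 * A))
  (hκX : κX = 4 * (Real.sqrt 2 * π * Real.sqrt Kc + 2 * e₀) ^ 2 + 16 * (π * Real.sqrt Kc / 2 + e₀) ^ 2)
  (hcN : cN = (Real.sqrt 2 * (1 + (4 + 4 * A) * r ^ 2 * e₀) / ((2 * B.rhomin - 4 * A) * π) + 2) * (2 * Real.sqrt 2 * r / π + 2))

set_option maxHeartbeats 1600000 in -- large explicit constants: elaboration of the symbol-layer bounds and their packaging is slow (as p3 g10's W1 file)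
include B hA hADt hA3 he hz hz1 hgap h3 hlo hhi hβ hρA hd hd1 hd2 hd3 hZ hΦ hGs hB0 hB hcT hκt hG₁ hK₂ hκ₃ hκ hKc hr hκX hcN in
/-- **The uniform WEIGHTED `ℓ¹` bound of the character sum of one ISOTROPIC sector function `F_σ` on an admissible frame, at the master lemma's rates**:
`Σ_z (1 + s₀|z̃₀| + s₁|z̃₁| + s₁|z̃₂|)·‖S_σ(z)‖ ≤ √(a·b)·M·L²`, `s₀ = 2Λ_mβ/(2Mπκ_t)`, `s₁ = 2Λ_m/(πκ)`,
`a = 32768(πκ_t+1)(1+4√2)²κ_X`, `b = (210/π)c_N` — uniform in the scale `m`, the sector, `β ∈ [π/(4Λ_m), M/e₀]` and the volume, given the order-three frame datum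
`A₃Λ_m² ≤ a₃`. [cite: BenfattoGiulianiMastropietro2006, Lemma 2.2 (2.52)–(2.56), §2.6 (2.81)] -/
theorem charSumWt_klIso_le_rates (ha3 : A₃ * klScale e₀ m ^ 2 ≤ a₃) (hM : klScale e₀ m * β < π * (2 * M - 5)) (hMβ : β * e₀ ≤ M)
    (hLz : 3 * |2 * π / (L : ℝ)| ≤ z) (hLΛ : 1 ≤ (L : ℝ) * klScale e₀ m) (hΛβ : π / (4 * β) ≤ klScale e₀ m) :
    ∑ zz : TorusSite 1 (2 * M) × TorusSite 2 L,
        (1 + 2 * klScale e₀ m * β / (((2 * M : ℕ) : ℝ) * π * Real.sqrt (κt ^ 2)) * |(((zz.1 0).valMinAbs : ℤ) : ℝ)| +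
            2 * klScale e₀ m / (π * Real.sqrt Kc) * |(((zz.2 0).valMinAbs : ℤ) : ℝ)| +
            2 * klScale e₀ m / (π * Real.sqrt Kc) * |(((zz.2 1).valMinAbs : ℤ) : ℝ)|) *
          ‖∑ q : TorusSite 1 (2 * M) × TorusSite 2 L, (torusChar q.1 zz.1 * torusChar q.2 zz.2) • Gs q‖ ≤
      Real.sqrt (32768 * (π * Real.sqrt (κt ^ 2) + 1) * ((1 + 4 * Real.sqrt 2) ^ 2 * κX) * (210 / π * cN)) * M * (L : ℝ) ^ 2 := by
  classical
  have hL : (0 : ℝ) < L := Nat.cast_pos.2 (Nat.pos_of_ne_zero (NeZero.ne L))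
  have hMpos : (0 : ℝ) < M := Nat.cast_pos.2 (Nat.pos_of_ne_zero (NeZero.ne M))
  have hπ := Real.pi_pos
  have hA0 : 0 ≤ A := le_trans (norm_nonneg _) (hA 0 0 (by norm_num))
  have hA30 : 0 ≤ A₃ := le_trans (norm_nonneg _) (hA3 0)
  have hc : 0 < 2 * π / (L : ℝ) := by positivity
  have habs : |2 * π / (L : ℝ)| = 2 * π / L := abs_of_pos hc
  have hDt : 0 < B.Dtmin - 2 * A := by linarith
  have hγ : 0 < 2 * B.rhomin - 4 * A := by linarith
  have hsm := B.smax_pos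
  have hDt0 := B.Dtmin_pos
  -- the scale bookkeeping (isotropic resolution: `N = 2^{2m} = 4^m`, `ΛN = e₀`)
  set Λ : ℝ := klScale e₀ m with hΛdef
  set N : ℝ := (2 : ℝ) ^ (2 * m) with hNdef
  have hΛ : 0 < Λ := by rw [hΛdef, klScale]; positivity
  have hΛe : Λ ≤ e₀ := klScale_le_e0 he.le m
  have hN0 : 0 < N := by positivity
  have hΛN : Λ * N ≤ e₀ := by
    rw [hΛdef, hNdef, klScale, pow_mul]
    norm_num
  -- signs of the constants
  have hcT0 : 0 ≤ cT := by rw [hcT]; positivity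
  have hκt1 : 1 ≤ κt := by rw [hκt]; exact le_max_left _ _
  have hκtc : cT ≤ κt := by rw [hκt]; exact le_max_right _ _
  have hκt0 : 0 < κt := lt_of_lt_of_le one_pos hκt1
  have hsqt : Real.sqrt (κt ^ 2) = κt := Real.sqrt_sq hκt0.le
  have hcG0 : 0 < κt ^ 2 := by positivity
  have hG₁0 : 0 ≤ G₁ := by rw [hG₁]; positivity
  have hK₂0 : 0 ≤ K₂ := by rw [hK₂]; positivity
  have ha30 : 0 ≤ a₃ := le_trans (by positivity) ha3
  have hκ₃0 : 0 ≤ κ₃ := by rw [hκ₃]; positivity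
  have hκ1 : 1 ≤ κ := by rw [hκ]; exact le_max_left _ _
  have hκ3 : κ₃ ≤ κ := by rw [hκ]; exact le_max_right _ _
  have hκ0 : 0 < κ := lt_of_lt_of_le one_pos hκ1
  have hK0 : 0 < Kc := by rw [hKc]; positivity
  have hsqK : Real.sqrt Kc = κ := by rw [hKc]; exact Real.sqrt_sq hκ0.le
  have hr0 : 0 ≤ r := by rw [hr]; positivity
  have hκX0 : 0 ≤ κX := by rw [hκX]; positivity
  have hcN0 : 0 ≤ cN := by rw [hcN]; positivity
  -- the iso cell radius `ρ = r·Λ`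
  have hw2m : sectorWidth (2 * m) = π * Λ / e₀ := by
    rw [hΛdef, sectorWidth, klScale, pow_mul]; field_simp; norm_num
  have hρeq : (Λ + B.smax * B.Dtmin * (3 * sectorWidth (2 * m) / 4)) / (B.Dtmin - 2 * A) = r * Λ := by
    rw [hr, hw2m, div_mul_eq_mul_div, div_eq_iff hDt.ne', div_mul_cancel₀ _ hDt.ne']
    field_simp
  obtain ⟨hDn, hDn0⟩ := one_add_six_div_sectorWidth_le (2 * m)
  -- admissibility of the unit steps (`6π ≤ zL`)
  have huax : ∀ (i j : Fin 2), 3 * |2 * π / (L : ℝ)| * |(((Pi.single i (1 : ℤ) : Fin 2 → ℤ) j : ℤ) : ℝ)| ≤ z := by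
    intro i j
    have h1 : |(((Pi.single i (1 : ℤ) : Fin 2 → ℤ) j : ℤ) : ℝ)| ≤ 1 := by
      by_cases hj : j = i
      · subst hj; simp
      · simp [hj]
    calc 3 * |2 * π / (L : ℝ)| * |(((Pi.single i (1 : ℤ) : Fin 2 → ℤ) j : ℤ) : ℝ)| ≤ 3 * |2 * π / (L : ℝ)| * 1 :=
          mul_le_mul_of_nonneg_left h1 (by positivity)
      _ ≤ z := by rw [mul_one]; exact hLz
  -- (0) the pointwise bounds in the master lemma's currency
  have hP0 : (0 : ℝ) < ((2 * M : ℕ) : ℝ) := Nat.cast_pos.2 (Nat.pos_of_ne_zero (mul_ne_zero two_ne_zero (NeZero.ne M)))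
  -- time, order three
  have h0' : ∀ q, ‖((fwdDiff ((fun _ : Fin 1 => (1 : ZMod (2 * M))), (0 : TorusSite 2 L)))^[3] Gs) q‖ ≤
      1 * (4 / (2 * Λ * β / (((2 * M : ℕ) : ℝ) * π * Real.sqrt (κt ^ 2)) * ((2 * M : ℕ) : ℝ))) ^ 3 := by
    intro q
    have h := norm_fwdDiff_three_time_klIso_le hA he hz h3 hβ σ hd1 hd2 hd3 hZ hΦ hGs hM q
    refine h.trans ?_
    rw [← hcT]
    exact cu_rate_time_le (by rw [hsqt]; exact hκt1) (by rw [hsqt]; exact hκtc) hΛ hβ hP0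
  -- axes, order three (isotropic packaging for a step of size `2π/L`)
  have h1' : ∀ q (i : Fin 2), ‖((fwdDiff ((0 : TorusSite 1 (2 * M)), (Pi.single i (1 : ZMod L) : TorusSite 2 L)))^[3] Gs) q‖ ≤
      1 * (4 / (2 * Λ / (π * Real.sqrt Kc) * L)) ^ 3 := by
    intro q i
    have hraw := norm_fwdDiff_three_space_klIso_le hA hA3 he hz hz1 hgap h3 σ hd hd1 hd2 hd3 hZ hΦ hGs hB0.le hB (Pi.single i 1) (huax i) q
    rw [axisStep_cast] at hraw
    have hpack : ‖((fwdDiff ((0 : TorusSite 1 (2 * M)), (Pi.single i (1 : ZMod L) : TorusSite 2 L)))^[3] Gs) q‖ ≤ κ₃ * (2 * π / L) ^ 3 / Λ ^ 3 := by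
      refine hraw.trans ?_
      rw [hκ₃, hG₁, hK₂]
      exact iso3_pack_le (by positivity) (by positivity) (by positivity) (by positivity) (by positivity) hA30 hB0.le hΛ hN0.le hc.le
        (norm_nonneg _) (le_of_eq (norms_axisStep L i).1) (norm_nonneg _) (by rw [(norms_axisStep L i).2]; linarith only [hc])
        hDn0 hDn hΛe hΛN ha3
    refine hpack.trans ?_
    exact cu_rate_space_le (by rw [hsqK]; exact hκ1) (by rw [hsqK]; exact hκ3) hΛ hL
  -- sup and support
  have hsup : ∀ q, ‖Gs q‖ ≤ 1 := fun q => by rw [hGs q]; exact norm_klIsoFamily_le_one β μ K e₀ m σ _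
  have hNs := card_support_klIso_le B hA hADt he hz hz1 hgap h3 hlo hhi hβ hρA σ hd1 hd2 hZ hΦ hGs
  rw [hρeq] at hNs
  -- the master lemma at the clean rates
  have hs₀ : 0 < 2 * Λ * β / (((2 * M : ℕ) : ℝ) * π * Real.sqrt (κt ^ 2)) := by rw [hsqt]; positivity
  have hsK : 0 < Real.sqrt Kc := by rw [hsqK]; exact hκ0
  have hs₁ : 0 < 2 * Λ / (π * Real.sqrt Kc) := by positivity
  have main := sum_wt_norm_charSum_le_of_third_differences_axes Gs hs₀ hs₁ zero_le_one (le_refl _) hsup h0' h1'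
  refine main.trans ?_
  -- the final bookkeeping
  have hP : ((2 * M : ℕ) : ℝ) = 2 * (M : ℝ) := by push_cast; ring
  rw [hP]
  have hΛβM : Λ * β ≤ M := (mul_le_mul_of_nonneg_right hΛe hβ.le).trans (by rw [mul_comm]; exact hMβ)
  have htfac : 1 / (2 * Λ * β / (2 * (M : ℝ) * π * Real.sqrt (κt ^ 2))) + 1 ≤ M / (Λ * β) * (π * Real.sqrt (κt ^ 2) + 1) :=
    tfac_le hcG0 hΛ hβ hMpos hΛβM
  have hbr := iso_bracket_le hK0 hΛ hΛe
  rw [← hκX] at hbr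
  have h42 : (1 : ℝ) ≤ (1 + 4 * Real.sqrt 2) ^ 2 := by
    have : (0 : ℝ) ≤ 4 * Real.sqrt 2 := by positivity
    nlinarith
  have hbr0 : 0 ≤ 16 * (1 / (2 * Λ / (π * Real.sqrt Kc)) + 1) ^ 2 := by positivity
  have hbr2 : (1 + 4 * Real.sqrt 2) ^ 2 * (4 * (2 * Real.sqrt 2 / (2 * Λ / (π * Real.sqrt Kc)) + 2) ^ 2) +
      16 * (1 / (2 * Λ / (π * Real.sqrt Kc)) + 1) ^ 2 ≤ (1 + 4 * Real.sqrt 2) ^ 2 * (κX / Λ ^ 2) := by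
    have hsq : 4 * (2 * Real.sqrt 2 / (2 * Λ / (π * Real.sqrt Kc)) + 2) ^ 2 =
        4 * ((2 * Real.sqrt 2 / (2 * Λ / (π * Real.sqrt Kc)) + 2) * (2 * Real.sqrt 2 / (2 * Λ / (π * Real.sqrt Kc)) + 2)) := by ring
    have h4 : 0 ≤ 4 * ((2 * Real.sqrt 2 / (2 * Λ / (π * Real.sqrt Kc)) + 2) * (2 * Real.sqrt 2 / (2 * Λ / (π * Real.sqrt Kc)) + 2)) := by
      positivity
    calc (1 + 4 * Real.sqrt 2) ^ 2 * (4 * (2 * Real.sqrt 2 / (2 * Λ / (π * Real.sqrt Kc)) + 2) ^ 2) +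
          16 * (1 / (2 * Λ / (π * Real.sqrt Kc)) + 1) ^ 2
        ≤ (1 + 4 * Real.sqrt 2) ^ 2 * (4 * (2 * Real.sqrt 2 / (2 * Λ / (π * Real.sqrt Kc)) + 2) ^ 2) +
          (1 + 4 * Real.sqrt 2) ^ 2 * (16 * (1 / (2 * Λ / (π * Real.sqrt Kc)) + 1) ^ 2) := by
          have := mul_le_mul_of_nonneg_right h42 hbr0
          linarith only [this]
      _ = (1 + 4 * Real.sqrt 2) ^ 2 * (4 * ((2 * Real.sqrt 2 / (2 * Λ / (π * Real.sqrt Kc)) + 2) *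
            (2 * Real.sqrt 2 / (2 * Λ / (π * Real.sqrt Kc)) + 2)) + 16 * (1 / (2 * Λ / (π * Real.sqrt Kc)) + 1) ^ 2) := by
          rw [hsq]; ring
      _ ≤ (1 + 4 * Real.sqrt 2) ^ 2 * (κX / Λ ^ 2) := mul_le_mul_of_nonneg_left hbr (by positivity)
  have hX1 : 32768 * (1 / (2 * Λ * β / (2 * (M : ℝ) * π * Real.sqrt (κt ^ 2))) + 1) *
      ((1 + 4 * Real.sqrt 2) ^ 2 * (4 * (2 * Real.sqrt 2 / (2 * Λ / (π * Real.sqrt Kc)) + 2) ^ 2) +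
        16 * (1 / (2 * Λ / (π * Real.sqrt Kc)) + 1) ^ 2) ≤
      32768 * (π * Real.sqrt (κt ^ 2) + 1) * ((1 + 4 * Real.sqrt 2) ^ 2 * κX) * (M / (Λ * β)) / Λ ^ 2 := by
    calc _ ≤ 32768 * (M / (Λ * β) * (π * Real.sqrt (κt ^ 2) + 1)) * ((1 + 4 * Real.sqrt 2) ^ 2 * (κX / Λ ^ 2)) := by
          gcongr
      _ = _ := by field_simp
  have hsupp := iso_supp_le (K₂ := 4 + 4 * A) (γ := 2 * B.rhomin - 4 * A) (ρ := r * Λ) hΛ hβ hL rfl hr0 (by positivity) hγ hLΛ hΛβ hΛe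
  rw [← hcN] at hsupp
  have hX2 : 21 * (2 * (M : ℝ)) * (L : ℝ) ^ 2 *
      ((((univ : Finset (TorusSite 1 (2 * M) × TorusSite 2 L)).filter fun q => Gs q ≠ 0).card : ℕ) : ℝ) ≤
      210 / π * cN * M * (Λ * β) * ((L : ℝ) ^ 2 * ((L : ℝ) * Λ) ^ 2) := by
    calc _ ≤ 21 * (2 * (M : ℝ)) * (L : ℝ) ^ 2 * (5 * Λ * β / π * ((L : ℝ) * Λ) ^ 2 * cN) := by
          gcongr; exact hNs.trans hsupp
      _ = 210 / π * cN * M * (Λ * β) * ((L : ℝ) ^ 2 * ((L : ℝ) * Λ) ^ 2) := by ring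
  exact isoWt_sqrt_assemble (a := 32768 * (π * Real.sqrt (κt ^ 2) + 1) * ((1 + 4 * Real.sqrt 2) ^ 2 * κX)) (b := 210 / π * cN)
    (by positivity) (by positivity) (by positivity) (by positivity) hMpos.le hΛ hβ hX1 hX2

set_option maxHeartbeats 1600000 in -- as above: the large constants make the statement and the term-wise domination slow to elaborate
include B hA hADt hA3 he hz hz1 hgap h3 hlo hhi hβ hρA hd hd1 hd2 hd3 hZ hΦ hGs hB0 hB hcT hκt hG₁ hK₂ hκ₃ hκ hKc hr hκX hcN in
/-- **The uniform weighted bound at the ENGINE's isotropic rates** (the weight of the `hisoW` datum of `isoMomFlowAt_of_wplainLine_isoSingle`: time rate `Λ_mβ/(2M)`,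
space rate `Λ_m`): `Σ_z (1 + (Λ_mβ/2M)|z̃₀| + Λ_m|z̃₁| + Λ_m|z̃₂|)·‖S_σ(z)‖ ≤ (π·max κ_t κ/2)·√(a·b)·M·L²`.
[cite: BenfattoGiulianiMastropietro2006, Lemma 2.2 (2.52)–(2.56), §2.6 (2.81)] -/
theorem charSumWt_klIso_le_uniform (ha3 : A₃ * klScale e₀ m ^ 2 ≤ a₃) (hM : klScale e₀ m * β < π * (2 * M - 5)) (hMβ : β * e₀ ≤ M)
    (hLz : 3 * |2 * π / (L : ℝ)| ≤ z) (hLΛ : 1 ≤ (L : ℝ) * klScale e₀ m) (hΛβ : π / (4 * β) ≤ klScale e₀ m) :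
    ∑ zz : TorusSite 1 (2 * M) × TorusSite 2 L,
        (1 + klScale e₀ m * β / (2 * M) * |(((zz.1 0).valMinAbs : ℤ) : ℝ)| + klScale e₀ m * |(((zz.2 0).valMinAbs : ℤ) : ℝ)| +
            klScale e₀ m * |(((zz.2 1).valMinAbs : ℤ) : ℝ)|) *
          ‖∑ q : TorusSite 1 (2 * M) × TorusSite 2 L, (torusChar q.1 zz.1 * torusChar q.2 zz.2) • Gs q‖ ≤
      π * max κt κ / 2 *
        (Real.sqrt (32768 * (π * Real.sqrt (κt ^ 2) + 1) * ((1 + 4 * Real.sqrt 2) ^ 2 * κX) * (210 / π * cN)) * M * (L : ℝ) ^ 2) := by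
  have hmain := charSumWt_klIso_le_rates B hA hADt hA3 he hz hz1 hgap h3 hlo hhi hβ hρA σ hd hd1 hd2 hd3 hZ hΦ hGs hB0 hB hcT hκt hG₁ hK₂
    hκ₃ hκ hKc hr hκX hcN ha3 hM hMβ hLz hLΛ hΛβ
  have hMpos : (0 : ℝ) < M := Nat.cast_pos.2 (Nat.pos_of_ne_zero (NeZero.ne M))
  have hπ := Real.pi_pos
  have hπ3 := Real.pi_gt_three
  have hΛ : 0 < klScale e₀ m := by rw [klScale]; positivity
  have hκt1 : 1 ≤ κt := by rw [hκt]; exact le_max_left _ _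
  have hκt0 : 0 < κt := lt_of_lt_of_le one_pos hκt1
  have hsqt : Real.sqrt (κt ^ 2) = κt := Real.sqrt_sq hκt0.le
  have hκ1 : 1 ≤ κ := by rw [hκ]; exact le_max_left _ _
  have hκ0 : 0 < κ := lt_of_lt_of_le one_pos hκ1
  have hsqK : Real.sqrt Kc = κ := by rw [hKc]; exact Real.sqrt_sq hκ0.le
  have hP : ((2 * M : ℕ) : ℝ) = 2 * (M : ℝ) := by push_cast; ring
  have hmx0 : 1 ≤ max κt κ := hκt1.trans (le_max_left _ _)
  have hCw1 : 1 ≤ π * max κt κ / 2 := by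
    have h31 : 3 * 1 ≤ π * max κt κ := mul_le_mul hπ3.le hmx0 zero_le_one hπ.le
    linarith only [h31]
  have hCwt : π * κt / 2 ≤ π * max κt κ / 2 := by
    have h := mul_le_mul_of_nonneg_left (le_max_left κt κ) hπ.le
    linarith only [h]
  have hCwx : π * κ / 2 ≤ π * max κt κ / 2 := by
    have h := mul_le_mul_of_nonneg_left (le_max_right κt κ) hπ.le
    linarith only [h]
  have e0 : klScale e₀ m * β / (2 * M) = π * κt / 2 * (2 * klScale e₀ m * β / (((2 * M : ℕ) : ℝ) * π * Real.sqrt (κt ^ 2))) := by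
    rw [hsqt, hP]; field_simp
  have e1 : klScale e₀ m = π * κ / 2 * (2 * klScale e₀ m / (π * Real.sqrt Kc)) := by
    rw [hsqK]; field_simp
  have hpt : ∀ zz : TorusSite 1 (2 * M) × TorusSite 2 L,
      (1 + klScale e₀ m * β / (2 * M) * |(((zz.1 0).valMinAbs : ℤ) : ℝ)| + klScale e₀ m * |(((zz.2 0).valMinAbs : ℤ) : ℝ)| +
          klScale e₀ m * |(((zz.2 1).valMinAbs : ℤ) : ℝ)|) ≤
        π * max κt κ / 2 *
          (1 + 2 * klScale e₀ m * β / (((2 * M : ℕ) : ℝ) * π * Real.sqrt (κt ^ 2)) * |(((zz.1 0).valMinAbs : ℤ) : ℝ)| +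
            2 * klScale e₀ m / (π * Real.sqrt Kc) * |(((zz.2 0).valMinAbs : ℤ) : ℝ)| +
            2 * klScale e₀ m / (π * Real.sqrt Kc) * |(((zz.2 1).valMinAbs : ℤ) : ℝ)|) := by
    intro zz
    have hs0 : 0 ≤ 2 * klScale e₀ m * β / (((2 * M : ℕ) : ℝ) * π * Real.sqrt (κt ^ 2)) * |(((zz.1 0).valMinAbs : ℤ) : ℝ)| := by
      rw [hsqt]; positivity
    have hs1 : 0 ≤ 2 * klScale e₀ m / (π * Real.sqrt Kc) * |(((zz.2 0).valMinAbs : ℤ) : ℝ)| := by rw [hsqK]; positivity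
    have hs2 : 0 ≤ 2 * klScale e₀ m / (π * Real.sqrt Kc) * |(((zz.2 1).valMinAbs : ℤ) : ℝ)| := by rw [hsqK]; positivity
    have ht : klScale e₀ m * β / (2 * M) * |(((zz.1 0).valMinAbs : ℤ) : ℝ)| ≤
        π * max κt κ / 2 * (2 * klScale e₀ m * β / (((2 * M : ℕ) : ℝ) * π * Real.sqrt (κt ^ 2)) * |(((zz.1 0).valMinAbs : ℤ) : ℝ)|) := by
      calc klScale e₀ m * β / (2 * M) * |(((zz.1 0).valMinAbs : ℤ) : ℝ)|
          = π * κt / 2 * (2 * klScale e₀ m * β / (((2 * M : ℕ) : ℝ) * π * Real.sqrt (κt ^ 2)) * |(((zz.1 0).valMinAbs : ℤ) : ℝ)|) := by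
            rw [← mul_assoc, ← e0]
        _ ≤ _ := mul_le_mul_of_nonneg_right hCwt hs0
    have hx1 : klScale e₀ m * |(((zz.2 0).valMinAbs : ℤ) : ℝ)| ≤
        π * max κt κ / 2 * (2 * klScale e₀ m / (π * Real.sqrt Kc) * |(((zz.2 0).valMinAbs : ℤ) : ℝ)|) := by
      calc klScale e₀ m * |(((zz.2 0).valMinAbs : ℤ) : ℝ)|
          = π * κ / 2 * (2 * klScale e₀ m / (π * Real.sqrt Kc) * |(((zz.2 0).valMinAbs : ℤ) : ℝ)|) := by
            rw [← mul_assoc, ← e1]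
        _ ≤ _ := mul_le_mul_of_nonneg_right hCwx hs1
    have hx2 : klScale e₀ m * |(((zz.2 1).valMinAbs : ℤ) : ℝ)| ≤
        π * max κt κ / 2 * (2 * klScale e₀ m / (π * Real.sqrt Kc) * |(((zz.2 1).valMinAbs : ℤ) : ℝ)|) := by
      calc klScale e₀ m * |(((zz.2 1).valMinAbs : ℤ) : ℝ)|
          = π * κ / 2 * (2 * klScale e₀ m / (π * Real.sqrt Kc) * |(((zz.2 1).valMinAbs : ℤ) : ℝ)|) := by
            rw [← mul_assoc, ← e1]
        _ ≤ _ := mul_le_mul_of_nonneg_right hCwx hs2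
    rw [mul_add, mul_add, mul_add, mul_one]
    linarith only [ht, hx1, hx2, hCw1]
  calc _ ≤ ∑ zz : TorusSite 1 (2 * M) × TorusSite 2 L, π * max κt κ / 2 *
          (1 + 2 * klScale e₀ m * β / (((2 * M : ℕ) : ℝ) * π * Real.sqrt (κt ^ 2)) * |(((zz.1 0).valMinAbs : ℤ) : ℝ)| +
            2 * klScale e₀ m / (π * Real.sqrt Kc) * |(((zz.2 0).valMinAbs : ℤ) : ℝ)| +
            2 * klScale e₀ m / (π * Real.sqrt Kc) * |(((zz.2 1).valMinAbs : ℤ) : ℝ)|) *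
          ‖∑ q : TorusSite 1 (2 * M) × TorusSite 2 L, (torusChar q.1 zz.1 * torusChar q.2 zz.2) • Gs q‖ :=
        Finset.sum_le_sum fun zz _ => mul_le_mul_of_nonneg_right (hpt zz) (norm_nonneg _)
    _ = π * max κt κ / 2 * ∑ zz : TorusSite 1 (2 * M) × TorusSite 2 L,
          (1 + 2 * klScale e₀ m * β / (((2 * M : ℕ) : ℝ) * π * Real.sqrt (κt ^ 2)) * |(((zz.1 0).valMinAbs : ℤ) : ℝ)| +
            2 * klScale e₀ m / (π * Real.sqrt Kc) * |(((zz.2 0).valMinAbs : ℤ) : ℝ)| +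
            2 * klScale e₀ m / (π * Real.sqrt Kc) * |(((zz.2 1).valMinAbs : ℤ) : ℝ)|) *
          ‖∑ q : TorusSite 1 (2 * M) × TorusSite 2 L, (torusChar q.1 zz.1 * torusChar q.2 zz.2) • Gs q‖ := by
        rw [Finset.mul_sum]
        exact Finset.sum_congr rfl fun zz _ => by ring
    _ ≤ _ := mul_le_mul_of_nonneg_left hmain (by positivity)

end IsoWt

end Summit.HubbardSuperconductivity.HubbardSuperconductivity.Theorems.TorusFourierL2

end
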